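import Summits.FinalStateConjecture.FinalStateConjecture.Cruxes.KillingSpinorEndgame.Lines.birth

/-!
# Scratch for stub `stub_gaugeConsolidation` (line `registered`, crux stmt-FinalStateConjecture-17645)

Outcome: `stub-misstated` — see `StubGaugeConsolidation.md` next to this file. This file only
ELABORATES the proposed corrected interface (`GaugeAlongFar`, `Sig.stub_gaugeConsolidation'`); it
proves nothing and is not proposed to the tree.
-/

open Literature.Geometry.Lorentzian
open scoped Manifold ContDiff Topology ENNReal
open Filter Set TopologicalSpace

set_option linter.dupNamespace false

namespace Summit.FinalStateConjecture.FinalStateConjecture.Cruxes.KillingSpinorEndgame.Birth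

open Summit.FinalStateConjecture.FinalStateConjecture.Theses.KerrnessPropagates

noncomputable section

namespace Scratch

variable {X : Type} [TopologicalSpace X] [ChartedSpace E3 X] [IsManifold (𝓡 3) ∞ X]
  [ConnectedSpace X] {D : InitialDataSet (𝓡 3) X}

/-- Proposed repair of `GaugeAlong`: the seven clauses verbatim PLUS a hole-relative far-decay clause
with log-rate, uniform in the lab time: on `{x⁰ = τ, far zone, |x̲| ≥ L, ∀ j, r_j ≥ L}` the `Cᵏ`
deviation from Minkowski is `≤ w(L)` with `w(L) log L → 0` (`ω` is a reserved token here). -/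
def GaugeAlongFar (𝒟 : VacuumCauchyDevelopment D) (k N : ℕ) (M a r₀ : Fin N → ℝ)
    (mo : Fin N → ↥lorentzGroup × E4) (δ : ℝ → ℝ) : Prop :=
  ∃ (U : Opens E4) (Φ : U → 𝒟.carrier) (τ₀ : ℝ) (R : Fin N → ℝ → ℝ),
    ContMDiff 𝓘(ℝ, E4) (𝓡 4) ∞ Φ ∧ Topology.IsOpenEmbedding Φ ∧
    {x : E4 | τ₀ < x 0 ∧ ∀ j, r₀ j < Kerr.radius (a j) (poincareInv (mo j).1 (mo j).2 x)} ⊆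
      (U : Set E4) ∧
    range Φ ⊆ 𝒟.metric.causalFuture 𝒟.timeOrientation (range 𝒟.embed) ∧
    (∀ i, Tendsto (R i) atTop atTop) ∧ (∀ i τ, r₀ i + 1 ≤ R i τ) ∧
    (∀ τ : ℝ, τ₀ < τ →
      𝒟.metric.IsAchronal 𝒟.timeOrientation (Φ '' {x : ↥U | (x : E4) 0 = τ}) ∧
      (∀ i, supCkENorm {x : E4 | x 0 = τ ∧
          (∀ j, r₀ j < Kerr.radius (a j) (poincareInv (mo j).1 (mo j).2 x)) ∧
          Kerr.radius (a i) (poincareInv (mo i).1 (mo i).2 x) ≤ R i τ} k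
        (𝒟.toSpacetime.deviationExtend ⟨U, boostedKerrBilin (mo i).1 (mo i).2 (M i) (a i),
          fun x ↦ x 0, fun x ↦ Kerr.radius (a i) (poincareInv (mo i).1 (mo i).2 x)⟩ Φ) ≤
        ENNReal.ofReal (δ τ)) ∧
      supCkENorm {x : E4 | x 0 = τ ∧
          (∀ j, r₀ j < Kerr.radius (a j) (poincareInv (mo j).1 (mo j).2 x)) ∧
          ∀ j, R j τ - 1 ≤ Kerr.radius (a j) (poincareInv (mo j).1 (mo j).2 x)} k
        (𝒟.toSpacetime.deviationExtend (Minkowski.backgroundOn U) Φ) ≤ ENNReal.ofReal (δ τ) ∧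
      (∀ x : ↥U, x.1 0 = τ →
        (∀ j, R j τ - 1 ≤ Kerr.radius (a j) (poincareInv (mo j).1 (mo j).2 x.1)) →
        𝒟.timeOrientation.IsFutureDirected (mfderiv 𝓘(ℝ, E4) (𝓡 4) Φ x (E4.basisVector 0)))) ∧
    ∃ w : ℝ → ℝ, Tendsto (fun L ↦ w L * Real.log L) atTop (𝓝 0) ∧
      ∀ τ : ℝ, τ₀ < τ → ∀ L : ℝ,
        supCkENorm {x : E4 | x 0 = τ ∧
            (∀ j, r₀ j < Kerr.radius (a j) (poincareInv (mo j).1 (mo j).2 x)) ∧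
            (∀ j, R j τ - 1 ≤ Kerr.radius (a j) (poincareInv (mo j).1 (mo j).2 x)) ∧
            L ≤ E4.spatialNorm x ∧
            ∀ j, L ≤ Kerr.radius (a j) (poincareInv (mo j).1 (mo j).2 x)} k
          (𝒟.toSpacetime.deviationExtend (Minkowski.backgroundOn U) Φ) ≤ ENNReal.ofReal (w L)

/-- The strengthened gauge forgets to the line's `GaugeAlong` (pure logic). -/
theorem GaugeAlongFar.gaugeAlong {𝒟 : VacuumCauchyDevelopment D} {k N : ℕ} {M a r₀ : Fin N → ℝ}
    {mo : Fin N → ↥lorentzGroup × E4} {δ : ℝ → ℝ} (h : GaugeAlongFar 𝒟 k N M a r₀ mo δ) :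
    GaugeAlong 𝒟 k N M a r₀ mo δ := by
  obtain ⟨U, Φ, τ₀, R, h1, h2, h3, h4, h5, h6, h7, -⟩ := h
  exact ⟨U, Φ, τ₀, R, h1, h2, h3, h4, h5, h6, h7⟩

/-- Proposed corrected signature of stub 2 (consolidation): hypothesis family strengthened by the
far-decay clause, conclusion unchanged. -/
def Sig.stub_gaugeConsolidation' : Prop :=
  ∀ (X : Type) [TopologicalSpace X] [ChartedSpace E3 X] [IsManifold (𝓡 3) ∞ X]
    [T2Space X] [SecondCountableTopology X] [ConnectedSpace X] (D : InitialDataSet (𝓡 3) X),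
    D ∈ admissibleVacuumData X → ∀ 𝒟 : VacuumCauchyDevelopment D, 𝒟.IsMaximal →
    Summit.FinalStateConjecture.HasCompleteNullInfinity 𝒟.toCauchyDevelopment →
    ∀ (N : ℕ) (M a r₀ : Fin N → ℝ) (mo : Fin N → ↥lorentzGroup × E4),
    (∀ i, Kerr.IsSubextremal (M i) (a i) ∧
      r₀ i ∈ Ioo (Kerr.rMinus (M i) (a i)) (Kerr.rPlus (M i) (a i))) →
    (∀ η : ℝ, 0 < η → GaugeAlongFar 𝒟 2 N M a r₀ mo (fun _ ↦ η)) → GlobalGauge 𝒟 2 N M a r₀ mo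

end Scratch

end

end Summit.FinalStateConjecture.FinalStateConjecture.Cruxes.KillingSpinorEndgame.Birth
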